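import Summits.CriticalPhenomena.PercolationContinuityZ3.Theorems.PercNearOneGluingNoHeavyLowerTailKnQuestion8CoefficientwiseQmixRootEdgeWall
import HarnessLib

/-!
# The two-point exclusion at a point with a ROOT EDGE, part 3: `Q_mix(p,q)[1_u, g] ≥ 0` for `N(u) = {p, q, x}` modulo two ROOT-DOM wall sums, and unconditionally under
# separation — prim-lf-2 gen 51 (part 3 of 4)

Support file (`--supports stmt-CriticalPhenomena-4575`, closed), prover `prim-lf-2` (gen 51).  No definitions, no named facts, no sorries; standard axioms.
Memo `prim-lf-2/CW-ROOTEDGE-gen51.md` §1–§3; parts 1–2: `…CoefficientwiseQmixRootEdgeClasses.lean`, `…CoefficientwiseQmixRootEdgeWall.lean`.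

Setting.  Finite multigraph `ends : ι → Sym2 V`, root `x`, `K(s) = openCluster (ends '' s) x`, and a vertex `u ∉ {x, p, q}` whose edges are EXACTLY `i_p = up`, `i_q = uq`,
`i_x = ux` (a degree-three point adjacent to the root — gen 50's DIAMOND `N(u) = {p,q}` plus a root edge; this is the shape of the whole 6-vertex residue of CONJECTURE NO-CORE for
the point functions, prim-lf-2 CW-TWOSOURCE-gen50 §1.3).  Resolving the star `D = {i_p, i_q, i_x}`: the four classes with `i_p` red and the two with `i_p, i_q` blue are `≥ 0` by
gen 49 (`qmixStarClass_nonneg_of_red`, `_blue_blue`); the classes `{i_q, i_x}` and `{i_q}` are bounded below by the ROOT-DOM wall sums `WC_{{i_q,i_x}}(p)` and `WC_{{i_p,i_x}}(q)`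
(part 1).  Hence:
* `qmix_rootEdge_nonneg_of_wallClasses` — `Q_mix(p,q)[1_u,g] ≥ 0` as soon as the two wall sums are `≥ 0` (CONJECTURE ROOT-DOM of prim-lf-2 gen 25/29 for the minors
  `G − u + xq` at `p` and `G − u + xp` at `q`; census-clean, open);
* `qmix_rootEdge_nonneg_of_sep` — **THEOREM:** if every open `p–q` connection among the edges off `D` passes through `x` (i.e. `x` separates `p` from `q` in `G − u`), then
  `Q_mix(p,q)[1_u, g] ≥ 0` for EVERY monotone `g` (part 2's `wallClass_nonneg_of_sep` twice);
* `qmix_rootEdge_pointIndicator_nonneg_of_sep` — **THEOREM (points):** if every such connection passes through `x` or `w` (`w ≠ u`), then `Q_mix(p,q)[1_u, 1_w] ≥ 0`;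
* `wallClass_eq_zero_of_adj_root`, `qmix_rootEdge_nonneg_of_adj_root` — a wall sum at a neighbour of the root is EMPTY, so `Q_mix(p,q)[1_u,g] ≥ 0` for every monotone `g` when
  `p ∼ x` and `q ∼ x` (every vertex of `N(u)` adjacent to the root).
Part 4 (`…QmixRootEdgeNoCore.lean`) feeds these into gen 48's degree-two reduction: NO-CORE(y)[1_u, 1_w] ≥ 0 for `deg y = 2`, `N(y) = {p,q}`, `N(u) = {p,q,x}` whenever `{x, w}`
separates `p` from `q` in `G − y − u` — at 6 vertices every residual `(G,y)` of gen 50 without the edge `pq` (33 of 108; prim-lf-2 code/gen51/nccov51.c).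
[cite: KozmaNitzan2024, Questions 8–9 (§5.5 p. 36) (context: the Question-8 pocket covariance programme)]
-/

namespace Summit.CriticalPhenomena.PercolationContinuityZ3.Theorems

open Finset Literature.Probability.Percolation

namespace Coefficientwise

variable {ι V : Type*} [Fintype ι] [DecidableEq ι] (ends : ι → Sym2 V) (x : V)

section rootEdgeMain

variable {u p q : V} {i_p i_q i_x : ι}

open Classical in
/-- **`Q_mix(p,q)[1_u, g] ≥ 0` at a degree-three point adjacent to the root, modulo the two ROOT-DOM wall sums.**  Let `u ∉ {x,p,q}` have exactly the three (distinct) edges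
`i_p = up`, `i_q = uq`, `i_x = ux`, `D = {i_p, i_q, i_x}`.  If the wall class sums `WC_{{i_q,i_x}}(p)[g]` and `WC_{{i_p,i_x}}(q)[g]` (written out below; `r⁺ = r.map val` on the
sub-cube off `D`) are `≥ 0`, then `0 ≤ Q_mix(p,q)[1_u, g] = Σ_{s : ¬(p ∈ K s ∧ q ∈ K sᶜ)} ([u ∈ K s] − [u ∈ K sᶜ])·(g(K s) − g(K sᶜ))` for the monotone `g`.
(Star resolution `sum_cube_eq_sum_powerset_subcube`; six classes by gen 49's brackets, the two others by part 1.)  [cite: KozmaNitzan2024, Questions 8–9 (§5.5 p. 36) (context)] -/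
theorem qmix_rootEdge_nonneg_of_wallClasses (hi_p : ends i_p = s(u, p)) (hi_q : ends i_q = s(u, q)) (hi_x : ends i_x = s(u, x))
    (hpq : i_p ≠ i_q) (hpx : i_p ≠ i_x) (hqx : i_q ≠ i_x)
    (hdeg : ∀ i, u ∈ ends i → i = i_p ∨ i = i_q ∨ i = i_x) (hpu : p ≠ u) (hqu : q ≠ u) (hxu : x ≠ u)
    (g : Set V → ℝ) (hg : Monotone g)
    (hWp : 0 ≤ ∑ r : Finset {j : ι // j ∉ ({i_p, i_q, i_x} : Finset ι)},
      (if (p ∉ openCluster (ends '' (↑(r.map (Function.Embedding.subtype _) ∪ ({i_q, i_x} : Finset ι)) : Set ι)) x ∧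
            p ∉ openCluster (ends '' (↑(rᶜ.map (Function.Embedding.subtype _) ∪ (({i_p, i_q, i_x} : Finset ι) \ {i_q, i_x})) : Set ι)) x) then
        (g (openCluster (ends '' (↑(r.map (Function.Embedding.subtype _) ∪ ({i_q, i_x} : Finset ι)) : Set ι)) x) -
          g (openCluster (ends '' (↑(rᶜ.map (Function.Embedding.subtype _) ∪ (({i_p, i_q, i_x} : Finset ι) \ {i_q, i_x})) : Set ι)) x))
      else 0))
    (hWq : 0 ≤ ∑ r : Finset {j : ι // j ∉ ({i_p, i_q, i_x} : Finset ι)},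
      (if (q ∉ openCluster (ends '' (↑(r.map (Function.Embedding.subtype _) ∪ (({i_p, i_q, i_x} : Finset ι) \ {i_q})) : Set ι)) x ∧
            q ∉ openCluster (ends '' (↑(rᶜ.map (Function.Embedding.subtype _) ∪ ({i_q} : Finset ι)) : Set ι)) x) then
        (g (openCluster (ends '' (↑(r.map (Function.Embedding.subtype _) ∪ (({i_p, i_q, i_x} : Finset ι) \ {i_q})) : Set ι)) x) -
          g (openCluster (ends '' (↑(rᶜ.map (Function.Embedding.subtype _) ∪ ({i_q} : Finset ι)) : Set ι)) x))
      else 0)) :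
    0 ≤ ∑ s ∈ univ.filter (fun s : Finset ι => ¬ (p ∈ openCluster (ends '' (↑s : Set ι)) x ∧ q ∈ openCluster (ends '' (↑(sᶜ) : Set ι)) x)),
      ((if u ∈ openCluster (ends '' (↑s : Set ι)) x then (1 : ℝ) else 0) - (if u ∈ openCluster (ends '' (↑(sᶜ) : Set ι)) x then (1 : ℝ) else 0)) *
        (g (openCluster (ends '' (↑s : Set ι)) x) - g (openCluster (ends '' (↑(sᶜ) : Set ι)) x)) := by
  have hD : ∀ i ∈ ({i_p, i_q, i_x} : Finset ι), u ∈ ends i := by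
    intro i hi
    rcases Finset.mem_insert.mp hi with rfl | hi
    · rw [hi_p]; exact Sym2.mem_mk_left _ _
    · rcases Finset.mem_insert.mp hi with rfl | hi
      · rw [hi_q]; exact Sym2.mem_mk_left _ _
      · rw [Finset.mem_singleton.mp hi, hi_x]; exact Sym2.mem_mk_left _ _
  have hdeg' : ∀ i, u ∈ ends i → i ∈ ({i_p, i_q, i_x} : Finset ι) := by
    intro i hi
    rcases hdeg i hi with rfl | rfl | rfl <;> simp
  have hi_pD : i_p ∈ ({i_p, i_q, i_x} : Finset ι) := by simp
  have hi_qD : i_q ∈ ({i_p, i_q, i_x} : Finset ι) := by simp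
  have hi_xD : i_x ∈ ({i_p, i_q, i_x} : Finset ι) := by simp
  rw [Finset.sum_filter]
  rw [sum_cube_eq_sum_powerset_subcube ({i_p, i_q, i_x} : Finset ι) (fun s t =>
      if ¬ (p ∈ openCluster (ends '' (↑s : Set ι)) x ∧ q ∈ openCluster (ends '' (↑t : Set ι)) x) then
        ((if u ∈ openCluster (ends '' (↑s : Set ι)) x then (1 : ℝ) else 0) - (if u ∈ openCluster (ends '' (↑t : Set ι)) x then (1 : ℝ) else 0)) *
          (g (openCluster (ends '' (↑s : Set ι)) x) - g (openCluster (ends '' (↑t : Set ι)) x)) else 0)]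
  refine Finset.sum_nonneg fun R hR => ?_
  have hRD : R ⊆ ({i_p, i_q, i_x} : Finset ι) := Finset.mem_powerset.mp hR
  by_cases h1 : i_p ∈ R
  · exact qmixStarClass_nonneg_of_red ends x ({i_p, i_q, i_x} : Finset ι) R hRD hD hi_p hpu h1 q g hg
  · by_cases h2 : i_q ∈ R
    · by_cases h3 : i_x ∈ R
      · -- the class `{i_q, i_x}` red, `i_p` blue: part 1's red-root bound, then `hWp`
        have hReq : R = ({i_q, i_x} : Finset ι) := by
          ext a
          constructor
          · intro ha
            rcases Finset.mem_insert.mp (hRD ha) with rfl | ha'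
            · exact absurd ha h1
            · exact ha'
          · intro ha
            rcases Finset.mem_insert.mp ha with rfl | ha
            · exact h2
            · rw [Finset.mem_singleton.mp ha]; exact h3
        subst hReq
        have hP : ∀ i ∈ ({i_p, i_q, i_x} : Finset ι) \ {i_q, i_x}, ends i = s(u, p) := by
          intro i hi
          rw [Finset.mem_sdiff] at hi
          rcases Finset.mem_insert.mp hi.1 with rfl | hi'
          · exact hi_p
          · exact absurd hi' hi.2
        have he_p : i_p ∈ ({i_p, i_q, i_x} : Finset ι) \ {i_q, i_x} := Finset.mem_sdiff.mpr ⟨hi_pD, h1⟩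
        exact le_trans hWp (qmixStarClass_ge_wallClass_of_redRoot ends x ({i_p, i_q, i_x} : Finset ι) {i_q, i_x} hdeg' hi_x h3 hxu hP he_p hpu q g hg)
      · -- the class `{i_q}` red, `i_p, i_x` blue: part 1's blue-root bound, then `hWq`
        have hReq : R = ({i_q} : Finset ι) := by
          ext a
          constructor
          · intro ha
            rcases Finset.mem_insert.mp (hRD ha) with rfl | ha'
            · exact absurd ha h1
            · rcases Finset.mem_insert.mp ha' with rfl | ha'
              · exact Finset.mem_singleton_self _
              · rw [Finset.mem_singleton.mp ha'] at ha; exact absurd ha h3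
          · intro ha; rw [Finset.mem_singleton.mp ha]; exact h2
        subst hReq
        have hQ : ∀ i ∈ ({i_q} : Finset ι), ends i = s(u, q) := by
          intro i hi; rw [Finset.mem_singleton.mp hi]; exact hi_q
        have heₓ : i_x ∈ ({i_p, i_q, i_x} : Finset ι) \ {i_q} := Finset.mem_sdiff.mpr ⟨hi_xD, h3⟩
        exact le_trans hWq (qmixStarClass_ge_wallClass_of_blueRoot ends x ({i_p, i_q, i_x} : Finset ι) {i_q} hdeg' hi_x heₓ hxu hQ
          (Finset.mem_singleton_self i_q) hqu p g hg)
    · exact qmixStarClass_nonneg_of_blue_blue ends x ({i_p, i_q, i_x} : Finset ι) R hRD hD hi_p hpu (Finset.mem_sdiff.mpr ⟨hi_pD, h1⟩)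
        hi_q hqu (Finset.mem_sdiff.mpr ⟨hi_qD, h2⟩) g hg

open Classical in
/-- **THEOREM: `Q_mix(p,q)[1_u, g] ≥ 0` at a degree-three point adjacent to the root when `x` separates `p` from `q` off the point.**  Let `u ∉ {x,p,q}` have exactly the three
distinct edges `i_p = up`, `i_q = uq`, `i_x = ux`, and suppose that every red set `s` avoiding these three edges in which `q` is joined to `p` also joins `q` to `x` (`hsep`: every
`p–q` path of `G − u` passes through `x`).  Then `0 ≤ Σ_{s : ¬(p ∈ K s ∧ q ∈ K sᶜ)} ([u ∈ K s] − [u ∈ K sᶜ])·(g(K s) − g(K sᶜ))` for EVERY monotone `g` on every finite multigraph.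
[cite: KozmaNitzan2024, Questions 8–9 (§5.5 p. 36) (context)] -/
theorem qmix_rootEdge_nonneg_of_sep (hi_p : ends i_p = s(u, p)) (hi_q : ends i_q = s(u, q)) (hi_x : ends i_x = s(u, x))
    (hpq : i_p ≠ i_q) (hpx : i_p ≠ i_x) (hqx : i_q ≠ i_x)
    (hdeg : ∀ i, u ∈ ends i → i = i_p ∨ i = i_q ∨ i = i_x) (hpu : p ≠ u) (hqu : q ≠ u) (hxu : x ≠ u)
    (hsep : ∀ s : Finset ι, i_p ∉ s → i_q ∉ s → i_x ∉ s →
      p ∈ openCluster (ends '' (↑s : Set ι)) q → x ∈ openCluster (ends '' (↑s : Set ι)) q)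
    (g : Set V → ℝ) (hg : Monotone g) :
    0 ≤ ∑ s ∈ univ.filter (fun s : Finset ι => ¬ (p ∈ openCluster (ends '' (↑s : Set ι)) x ∧ q ∈ openCluster (ends '' (↑(sᶜ) : Set ι)) x)),
      ((if u ∈ openCluster (ends '' (↑s : Set ι)) x then (1 : ℝ) else 0) - (if u ∈ openCluster (ends '' (↑(sᶜ) : Set ι)) x then (1 : ℝ) else 0)) *
        (g (openCluster (ends '' (↑s : Set ι)) x) - g (openCluster (ends '' (↑(sᶜ) : Set ι)) x)) := by
  have hdeg' : ∀ i, u ∈ ends i → i ∈ ({i_p, i_q, i_x} : Finset ι) := by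
    intro i hi
    rcases hdeg i hi with rfl | rfl | rfl <;> simp
  have hi_pD : i_p ∈ ({i_p, i_q, i_x} : Finset ι) := by simp
  have hi_xD : i_x ∈ ({i_p, i_q, i_x} : Finset ι) := by simp
  have hoff : ∀ s : Finset ι, (∀ i ∈ s, i ∉ ({i_p, i_q, i_x} : Finset ι)) → i_p ∉ s ∧ i_q ∉ s ∧ i_x ∉ s := by
    intro s hs
    refine ⟨fun h => hs i_p h (by simp), fun h => hs i_q h (by simp), fun h => hs i_x h (by simp)⟩
  -- separation in the two orientations
  have hsep_p : ∀ s : Finset ι, (∀ i ∈ s, i ∉ ({i_p, i_q, i_x} : Finset ι)) →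
      p ∈ openCluster (ends '' (↑s : Set ι)) q → x ∈ openCluster (ends '' (↑s : Set ι)) q := by
    intro s hs hpq'
    obtain ⟨h1, h2, h3⟩ := hoff s hs
    exact hsep s h1 h2 h3 hpq'
  have hsep_q : ∀ s : Finset ι, (∀ i ∈ s, i ∉ ({i_p, i_q, i_x} : Finset ι)) →
      q ∈ openCluster (ends '' (↑s : Set ι)) p → x ∈ openCluster (ends '' (↑s : Set ι)) p := by
    intro s hs hqp
    have hpq' : p ∈ openCluster (ends '' (↑s : Set ι)) q := SimpleGraph.Reachable.symm hqp
    have hxq := hsep_p s hs hpq'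
    exact SimpleGraph.Reachable.trans (SimpleGraph.Reachable.symm hpq') hxq
  -- the wall sum at `p` (class `{i_q, i_x}`)
  have hRends : ∀ i ∈ ({i_q, i_x} : Finset ι), ends i = s(u, x) ∨ ends i = s(u, q) := by
    intro i hi
    rcases Finset.mem_insert.mp hi with rfl | hi
    · exact Or.inr hi_q
    · rw [Finset.mem_singleton.mp hi]; exact Or.inl hi_x
  have hP : ∀ i ∈ ({i_p, i_q, i_x} : Finset ι) \ {i_q, i_x}, ends i = s(u, p) := by
    intro i hi
    rw [Finset.mem_sdiff] at hi
    rcases Finset.mem_insert.mp hi.1 with rfl | hi'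
    · exact hi_p
    · exact absurd hi' hi.2
  have hWp := wallClass_nonneg_of_sep ends x ({i_p, i_q, i_x} : Finset ι) {i_q, i_x} hdeg' hi_x (by simp) hxu hi_q (by simp) hqu hRends hP hpu
    hsep_p g hg
  -- the wall sum at `q` (class `{i_p, i_x} = D ∖ {i_q}`)
  have hRends' : ∀ i ∈ ({i_p, i_q, i_x} : Finset ι) \ {i_q}, ends i = s(u, x) ∨ ends i = s(u, p) := by
    intro i hi
    rw [Finset.mem_sdiff, Finset.mem_singleton] at hi
    rcases Finset.mem_insert.mp hi.1 with rfl | hi'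
    · exact Or.inr hi_p
    · rcases Finset.mem_insert.mp hi' with rfl | hi'
      · exact absurd rfl hi.2
      · rw [Finset.mem_singleton.mp hi']; exact Or.inl hi_x
  have hsub : ({i_q} : Finset ι) ⊆ ({i_p, i_q, i_x} : Finset ι) := by
    intro a ha; rw [Finset.mem_singleton.mp ha]; simp
  have hDD : ({i_p, i_q, i_x} : Finset ι) \ (({i_p, i_q, i_x} : Finset ι) \ {i_q}) = {i_q} := Finset.sdiff_sdiff_eq_self hsub
  have hP' : ∀ i ∈ ({i_p, i_q, i_x} : Finset ι) \ (({i_p, i_q, i_x} : Finset ι) \ {i_q}), ends i = s(u, q) := by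
    intro i hi; rw [hDD, Finset.mem_singleton] at hi; rw [hi]; exact hi_q
  have hWq := wallClass_nonneg_of_sep ends x ({i_p, i_q, i_x} : Finset ι) (({i_p, i_q, i_x} : Finset ι) \ {i_q}) hdeg' hi_x
    (Finset.mem_sdiff.mpr ⟨hi_xD, by rw [Finset.mem_singleton]; exact fun h => hqx h.symm⟩) hxu hi_p
    (Finset.mem_sdiff.mpr ⟨hi_pD, by rw [Finset.mem_singleton]; exact hpq⟩) hpu hRends' hP' hqu hsep_q g hg
  rw [hDD] at hWq
  exact qmix_rootEdge_nonneg_of_wallClasses ends x hi_p hi_q hi_x hpq hpx hqx hdeg hpu hqu hxu g hg hWp hWq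

open Classical in
/-- **THEOREM (points): `Q_mix(p,q)[1_u, 1_w] ≥ 0` at a degree-three point adjacent to the root when `{x, w}` separates `p` from `q` off the point.**  Let `u ∉ {x,p,q,w}` have exactly
the three distinct edges `i_p = up`, `i_q = uq`, `i_x = ux`, and suppose every red set `s` avoiding them in which `q` is joined to `p` joins `q` to `x` or to `w` (`hsep`: every `p–q`
path of `G − u` meets `{x, w}`).  Then `0 ≤ Σ_{s : ¬(p ∈ K s ∧ q ∈ K sᶜ)} ([u ∈ K s] − [u ∈ K sᶜ])·([w ∈ K s] − [w ∈ K sᶜ])` on every finite multigraph.  At 6 vertices this, with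
gen 48's degree-two reduction, settles every residual `(G, y)` of CONJECTURE NO-CORE for the points without the edge `pq` (prim-lf-2 CW-TWOSOURCE-gen50 §1.3: `deg y = 2`,
`N(y) = {p,q}`, both points adjacent to the root).  [cite: KozmaNitzan2024, Questions 8–9 (§5.5 p. 36) (context)] -/
theorem qmix_rootEdge_pointIndicator_nonneg_of_sep (hi_p : ends i_p = s(u, p)) (hi_q : ends i_q = s(u, q)) (hi_x : ends i_x = s(u, x))
    (hpq : i_p ≠ i_q) (hpx : i_p ≠ i_x) (hqx : i_q ≠ i_x)
    (hdeg : ∀ i, u ∈ ends i → i = i_p ∨ i = i_q ∨ i = i_x) (hpu : p ≠ u) (hqu : q ≠ u) (hxu : x ≠ u) {w : V} (hwu : w ≠ u)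
    (hsep : ∀ s : Finset ι, i_p ∉ s → i_q ∉ s → i_x ∉ s →
      p ∈ openCluster (ends '' (↑s : Set ι)) q → x ∈ openCluster (ends '' (↑s : Set ι)) q ∨ w ∈ openCluster (ends '' (↑s : Set ι)) q) :
    0 ≤ ∑ s ∈ univ.filter (fun s : Finset ι => ¬ (p ∈ openCluster (ends '' (↑s : Set ι)) x ∧ q ∈ openCluster (ends '' (↑(sᶜ) : Set ι)) x)),
      ((if u ∈ openCluster (ends '' (↑s : Set ι)) x then (1 : ℝ) else 0) - (if u ∈ openCluster (ends '' (↑(sᶜ) : Set ι)) x then (1 : ℝ) else 0)) *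
        ((if w ∈ openCluster (ends '' (↑s : Set ι)) x then (1 : ℝ) else 0) - (if w ∈ openCluster (ends '' (↑(sᶜ) : Set ι)) x then (1 : ℝ) else 0)) := by
  have hgm : Monotone (fun C : Set V => if w ∈ C then (1 : ℝ) else 0) := fun A B hAB => by
    by_cases hA : w ∈ A
    · simp [hA, hAB hA]
    · simp only [hA, if_false]; split_ifs <;> norm_num
  have hdeg' : ∀ i, u ∈ ends i → i ∈ ({i_p, i_q, i_x} : Finset ι) := by
    intro i hi
    rcases hdeg i hi with rfl | rfl | rfl <;> simp
  have hi_pD : i_p ∈ ({i_p, i_q, i_x} : Finset ι) := by simp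
  have hi_xD : i_x ∈ ({i_p, i_q, i_x} : Finset ι) := by simp
  have hoff : ∀ s : Finset ι, (∀ i ∈ s, i ∉ ({i_p, i_q, i_x} : Finset ι)) → i_p ∉ s ∧ i_q ∉ s ∧ i_x ∉ s := by
    intro s hs
    refine ⟨fun h => hs i_p h (by simp), fun h => hs i_q h (by simp), fun h => hs i_x h (by simp)⟩
  have hsep_p : ∀ s : Finset ι, (∀ i ∈ s, i ∉ ({i_p, i_q, i_x} : Finset ι)) →
      p ∈ openCluster (ends '' (↑s : Set ι)) q → x ∈ openCluster (ends '' (↑s : Set ι)) q ∨ w ∈ openCluster (ends '' (↑s : Set ι)) q := by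
    intro s hs hpq'
    obtain ⟨h1, h2, h3⟩ := hoff s hs
    exact hsep s h1 h2 h3 hpq'
  have hsep_q : ∀ s : Finset ι, (∀ i ∈ s, i ∉ ({i_p, i_q, i_x} : Finset ι)) →
      q ∈ openCluster (ends '' (↑s : Set ι)) p → x ∈ openCluster (ends '' (↑s : Set ι)) p ∨ w ∈ openCluster (ends '' (↑s : Set ι)) p := by
    intro s hs hqp
    have hpq' : p ∈ openCluster (ends '' (↑s : Set ι)) q := SimpleGraph.Reachable.symm hqp
    rcases hsep_p s hs hpq' with hxq | hwq
    · exact Or.inl (SimpleGraph.Reachable.trans (SimpleGraph.Reachable.symm hpq') hxq)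
    · exact Or.inr (SimpleGraph.Reachable.trans (SimpleGraph.Reachable.symm hpq') hwq)
  have hRends : ∀ i ∈ ({i_q, i_x} : Finset ι), ends i = s(u, x) ∨ ends i = s(u, q) := by
    intro i hi
    rcases Finset.mem_insert.mp hi with rfl | hi
    · exact Or.inr hi_q
    · rw [Finset.mem_singleton.mp hi]; exact Or.inl hi_x
  have hP : ∀ i ∈ ({i_p, i_q, i_x} : Finset ι) \ {i_q, i_x}, ends i = s(u, p) := by
    intro i hi
    rw [Finset.mem_sdiff] at hi
    rcases Finset.mem_insert.mp hi.1 with rfl | hi'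
    · exact hi_p
    · exact absurd hi' hi.2
  have hWp := wallClass_pointIndicator_nonneg_of_sep ends x ({i_p, i_q, i_x} : Finset ι) {i_q, i_x} hdeg' hi_x (by simp) hxu hi_q (by simp) hqu
    hRends hP hpu hwu hsep_p
  have hRends' : ∀ i ∈ ({i_p, i_q, i_x} : Finset ι) \ {i_q}, ends i = s(u, x) ∨ ends i = s(u, p) := by
    intro i hi
    rw [Finset.mem_sdiff, Finset.mem_singleton] at hi
    rcases Finset.mem_insert.mp hi.1 with rfl | hi'
    · exact Or.inr hi_p
    · rcases Finset.mem_insert.mp hi' with rfl | hi'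
      · exact absurd rfl hi.2
      · rw [Finset.mem_singleton.mp hi']; exact Or.inl hi_x
  have hsub : ({i_q} : Finset ι) ⊆ ({i_p, i_q, i_x} : Finset ι) := by
    intro a ha; rw [Finset.mem_singleton.mp ha]; simp
  have hDD : ({i_p, i_q, i_x} : Finset ι) \ (({i_p, i_q, i_x} : Finset ι) \ {i_q}) = {i_q} := Finset.sdiff_sdiff_eq_self hsub
  have hP' : ∀ i ∈ ({i_p, i_q, i_x} : Finset ι) \ (({i_p, i_q, i_x} : Finset ι) \ {i_q}), ends i = s(u, q) := by
    intro i hi; rw [hDD, Finset.mem_singleton] at hi; rw [hi]; exact hi_q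
  have hWq := wallClass_pointIndicator_nonneg_of_sep ends x ({i_p, i_q, i_x} : Finset ι) (({i_p, i_q, i_x} : Finset ι) \ {i_q}) hdeg' hi_x
    (Finset.mem_sdiff.mpr ⟨hi_xD, by rw [Finset.mem_singleton]; exact fun h => hqx h.symm⟩) hxu hi_p
    (Finset.mem_sdiff.mpr ⟨hi_pD, by rw [Finset.mem_singleton]; exact hpq⟩) hpu hRends' hP' hqu hwu hsep_q
  rw [hDD] at hWq
  exact qmix_rootEdge_nonneg_of_wallClasses ends x hi_p hi_q hi_x hpq hpx hqx hdeg hpu hqu hxu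
    (fun C : Set V => if w ∈ C then (1 : ℝ) else 0) hgm hWp hWq

open Classical in
/-- **A wall sum at a neighbour of the root is empty.**  If every edge of `D` contains `u` and some edge `i₀` has ends `{p, x}` (`p, x ≠ u`), then for every summand `G` the wall-restricted
sum `Σ_r [p ∉ a r][p ∉ b r]·G(r)` over the sub-cube off `D` vanishes (`i₀` is red or blue, so `p` is joined to `x` in one colour).
[cite: KozmaNitzan2024, §5.5 (context only; elementary)] -/
theorem wallClass_eq_zero_of_adj_root (D R : Finset ι) (hD : ∀ i ∈ D, u ∈ ends i) {i₀ : ι} (hi₀ : ends i₀ = s(p, x)) (hpu : p ≠ u) (hxu : x ≠ u) (hxp : x ≠ p)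
    (G : Finset {j : ι // j ∉ D} → ℝ) :
    ∑ r : Finset {j : ι // j ∉ D},
      (if (p ∉ openCluster (ends '' (↑(r.map (Function.Embedding.subtype _) ∪ R) : Set ι)) x ∧
            p ∉ openCluster (ends '' (↑(rᶜ.map (Function.Embedding.subtype _) ∪ (D \ R)) : Set ι)) x) then G r else 0) = 0 := by
  have hi₀D : i₀ ∉ D := by
    intro h
    have := hD i₀ h
    rw [hi₀, Sym2.mem_iff] at this
    rcases this with h1 | h1
    · exact hpu h1.symm
    · exact hxu h1.symm
  refine Finset.sum_eq_zero fun r _ => ?_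
  set emb := Function.Embedding.subtype (fun j : ι => j ∉ D) with hemb
  set j₀ : {j : ι // j ∉ D} := ⟨i₀, hi₀D⟩ with hj₀
  split_ifs with h
  · exfalso
    obtain ⟨h1, h2⟩ := h
    by_cases hr : j₀ ∈ r
    · have hmem : i₀ ∈ r.map emb ∪ R := Finset.mem_union_left _ (Finset.mem_map.mpr ⟨j₀, hr, rfl⟩)
      exact h1 ((mem_openCluster_iff_of_edge ends x (r.map emb ∪ R) hi₀ hxp hmem).mpr (mem_openCluster_self _ x))
    · have hr' : j₀ ∈ rᶜ := Finset.mem_compl.mpr hr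
      have hmem : i₀ ∈ rᶜ.map emb ∪ (D \ R) := Finset.mem_union_left _ (Finset.mem_map.mpr ⟨j₀, hr', rfl⟩)
      exact h2 ((mem_openCluster_iff_of_edge ends x (rᶜ.map emb ∪ (D \ R)) hi₀ hxp hmem).mpr (mem_openCluster_self _ x))
  · rfl

open Classical in
/-- **THEOREM: `Q_mix(p,q)[1_u, g] ≥ 0` at a degree-three point adjacent to the root when both other neighbours `p, q` are adjacent to the root too.**  Let `u ∉ {x,p,q}` have exactly the
three distinct edges `i_p = up`, `i_q = uq`, `i_x = ux`, and let `G` contain edges `k_p = px` and `k_q = qx`.  Then both ROOT-DOM wall sums are empty (`wallClass_eq_zero_of_adj_root`) and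
`0 ≤ Σ_{s : ¬(p ∈ K s ∧ q ∈ K sᶜ)} ([u ∈ K s] − [u ∈ K sᶜ])·(g(K s) − g(K sᶜ))` for EVERY monotone `g`.  [cite: KozmaNitzan2024, Questions 8–9 (§5.5 p. 36) (context)] -/
theorem qmix_rootEdge_nonneg_of_adj_root (hi_p : ends i_p = s(u, p)) (hi_q : ends i_q = s(u, q)) (hi_x : ends i_x = s(u, x))
    (hpq : i_p ≠ i_q) (hpx : i_p ≠ i_x) (hqx : i_q ≠ i_x)
    (hdeg : ∀ i, u ∈ ends i → i = i_p ∨ i = i_q ∨ i = i_x) (hpu : p ≠ u) (hqu : q ≠ u) (hxu : x ≠ u) (hxp : x ≠ p) (hxq : x ≠ q)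
    {k_p k_q : ι} (hk_p : ends k_p = s(p, x)) (hk_q : ends k_q = s(q, x))
    (g : Set V → ℝ) (hg : Monotone g) :
    0 ≤ ∑ s ∈ univ.filter (fun s : Finset ι => ¬ (p ∈ openCluster (ends '' (↑s : Set ι)) x ∧ q ∈ openCluster (ends '' (↑(sᶜ) : Set ι)) x)),
      ((if u ∈ openCluster (ends '' (↑s : Set ι)) x then (1 : ℝ) else 0) - (if u ∈ openCluster (ends '' (↑(sᶜ) : Set ι)) x then (1 : ℝ) else 0)) *
        (g (openCluster (ends '' (↑s : Set ι)) x) - g (openCluster (ends '' (↑(sᶜ) : Set ι)) x)) := by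
  have hD : ∀ i ∈ ({i_p, i_q, i_x} : Finset ι), u ∈ ends i := by
    intro i hi
    rcases Finset.mem_insert.mp hi with rfl | hi
    · rw [hi_p]; exact Sym2.mem_mk_left _ _
    · rcases Finset.mem_insert.mp hi with rfl | hi
      · rw [hi_q]; exact Sym2.mem_mk_left _ _
      · rw [Finset.mem_singleton.mp hi, hi_x]; exact Sym2.mem_mk_left _ _
  have hWp := wallClass_eq_zero_of_adj_root ends x ({i_p, i_q, i_x} : Finset ι) {i_q, i_x} hD hk_p hpu hxu hxp
    (fun r => g (openCluster (ends '' (↑(r.map (Function.Embedding.subtype _) ∪ ({i_q, i_x} : Finset ι)) : Set ι)) x) -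
      g (openCluster (ends '' (↑(rᶜ.map (Function.Embedding.subtype _) ∪ (({i_p, i_q, i_x} : Finset ι) \ {i_q, i_x})) : Set ι)) x))
  have hWq := wallClass_eq_zero_of_adj_root ends x ({i_p, i_q, i_x} : Finset ι) (({i_p, i_q, i_x} : Finset ι) \ {i_q}) hD hk_q hqu hxu hxq
    (fun r => g (openCluster (ends '' (↑(r.map (Function.Embedding.subtype _) ∪ (({i_p, i_q, i_x} : Finset ι) \ {i_q})) : Set ι)) x) -
      g (openCluster (ends '' (↑(rᶜ.map (Function.Embedding.subtype _) ∪ (({i_p, i_q, i_x} : Finset ι) \ (({i_p, i_q, i_x} : Finset ι) \ {i_q}))) : Set ι)) x))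
  have hsub : ({i_q} : Finset ι) ⊆ ({i_p, i_q, i_x} : Finset ι) := by
    intro a ha; rw [Finset.mem_singleton.mp ha]; simp
  have hDD : ({i_p, i_q, i_x} : Finset ι) \ (({i_p, i_q, i_x} : Finset ι) \ {i_q}) = {i_q} := Finset.sdiff_sdiff_eq_self hsub
  rw [hDD] at hWq
  exact qmix_rootEdge_nonneg_of_wallClasses ends x hi_p hi_q hi_x hpq hpx hqx hdeg hpu hqu hxu g hg (le_of_eq hWp.symm) (le_of_eq hWq.symm)

end rootEdgeMain

end Coefficientwise

end Summit.CriticalPhenomena.PercolationContinuityZ3.Theorems
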